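import Literature.NumberTheory.ComplexMultiplication.AbelianCMFamilyRankCharacters
import HarnessLib

/-!
# Nondegeneracy of a family of CM types = additivity of the rank + nondegeneracy of the members; for CM subfields of an
# ABELIAN field: every member nondegenerate and no odd character seen twice

Companion of `NumberTheory/ComplexMultiplication/CMTypeRankFamilies` (`rank(Σ) + |I| ≤ Σ_i rank(Φ_i) + 1`, i.e.
`Hg(∏_i A_i) ⊆ ∏_i Hg(A_i)`, and `rank(Φ_i) ≤ |E_i|/2 + 1`) and of `AbelianCMFamilyRankCharacters` (Kubota's Lemma 2
for families: the additivity defect is the excess multiplicity of the odd characters).  Since nondegeneracy of the family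
is the maximal value `rank(Σ) = Σ_i |E_i|/2 + 1`, it holds iff BOTH inequalities are equalities:

* `IsCMTypeWith.typeRank_sigmaType_eq_iff_add_card_eq_and_forall` (abstract, any group) and
  **`isNondegenerateFamily_iff_add_card_eq_and_forall`** (CM fields) — `Σ` is nondegenerate iff the rank is additive
  (`Hg(∏ A_i) = ∏ Hg(A_i)`) AND every member is nondegenerate (Gordon 7.5–7.7: "`A` is stably nondegenerate when
  `Hg(A)` is as large as possible");
* **`isNondegenerateFamily_iff_forall_and_pairwise_oddCharacters`** — for CM fields `e_i : K_i ↪ L` inside one ABELIAN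
  number field `L`: the family is nondegenerate iff every `Φ_i` is nondegenerate and NO odd character `χ` of `Gal(L/ℚ)`
  has `Σ_{g : ι∘g∘e_i ∈ Φ_i} χ(g) ≠ 0` for two different members — Kubota's Lemma 2 for families in its qualitative form
  (the field form, "the `K_i` pairwise meet in totally real fields", is `Summits/HodgeConjecture/CorCM/AbelianCMFieldsHodge`).

Theorems only; no definition, no named fact, no `sorry`.

## Sources

* [Kubota1965] T. Kubota, *On the field extension by complex multiplication*, Trans. AMS 118 (1965), §4 Lemma 2.
* [Gordon1999HodgeAVSurvey] B. B. Gordon, *A survey of the Hodge conjecture for abelian varieties*, §3 Theorem, 7.5–7.7,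
  9.4.1.
-/

set_option autoImplicit false

noncomputable section

open scoped BigOperators
open NumberField Module

namespace Literature.NumberTheory.ComplexMultiplication
open Literature.AlgebraicGeometry.Motives (CMType)
open Literature.AlgebraicGeometry.Pohlmann1968

/-! ### Abstract: maximal rank ⟺ additivity and maximal members -/

section Abstract

variable {G : Type*} [Group G] {I : Type*} [Fintype I] [Nonempty I] {E : I → Type*} [∀ i, MulAction G (E i)]
  [∀ i, Fintype (E i)] [∀ i, Nonempty (E i)]

/-- **`Σ` is nondegenerate iff the rank is additive and every member is nondegenerate**:
`rank(Σ) = |⊔_i E_i|/2 + 1 ⟺ (rank(Σ) + |I| = Σ_i rank(Φ_i) + 1 ∧ ∀ i, rank(Φ_i) = |E_i|/2 + 1)` — both inequalities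
`rank(Σ) + |I| ≤ Σ_i rank(Φ_i) + 1 ≤ Σ_i |E_i|/2 + |I| + 1` must be equalities. [cite: Gordon1999HodgeAVSurvey, 7.5–7.7] -/
theorem IsCMTypeWith.typeRank_sigmaType_eq_iff_add_card_eq_and_forall {ρ : G} {Φ : ∀ i, Set (E i)}
    (h : ∀ i, IsCMTypeWith ρ (Φ i)) :
    typeRank G (ComplexMultiplication.sigmaType Φ) = Fintype.card (Σ i, E i) / 2 + 1 ↔
      typeRank G (ComplexMultiplication.sigmaType Φ) + Fintype.card I = (∑ i, typeRank G (Φ i)) + 1 ∧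
        ∀ i, typeRank G (Φ i) = Fintype.card (E i) / 2 + 1 := by
  have hadd := typeRank_sigmaType_add_card_le h
  have hle : ∀ i, typeRank G (Φ i) ≤ Fintype.card (E i) / 2 + 1 := fun i => (h i).typeRank_le
  have hsum : ∑ i, typeRank G (Φ i) ≤ ∑ i, (Fintype.card (E i) / 2 + 1) := Finset.sum_le_sum fun i _ => hle i
  have htot : ∑ j, (Fintype.card (E j) / 2 + 1) = (∑ j, Fintype.card (E j) / 2) + Fintype.card I := by
    rw [Finset.sum_add_distrib, Finset.sum_const, Finset.card_univ, smul_eq_mul, mul_one]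
  rw [card_sigma_div_two h]
  rw [htot] at hsum
  constructor
  · intro hS
    have hsum_eq : ∑ i, typeRank G (Φ i) = (∑ j, Fintype.card (E j) / 2) + Fintype.card I := by omega
    refine ⟨by omega, fun i => ?_⟩
    by_contra hne
    have hlt : typeRank G (Φ i) < Fintype.card (E i) / 2 + 1 := lt_of_le_of_ne (hle i) hne
    have hsum_lt : ∑ j, typeRank G (Φ j) < ∑ j, (Fintype.card (E j) / 2 + 1) :=
      Finset.sum_lt_sum (fun j _ => hle j) ⟨i, Finset.mem_univ i, hlt⟩
    rw [htot] at hsum_lt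
    omega
  · rintro ⟨hA, hall⟩
    have hsum_eq : ∑ j, typeRank G (Φ j) = ∑ j, (Fintype.card (E j) / 2 + 1) :=
      Finset.sum_congr rfl fun j _ => hall j
    rw [htot] at hsum_eq
    omega

end Abstract

/-! ### CM fields -/

section Fields

variable {I : Type} {K : I → Type} [∀ i, Field (K i)] [∀ i, NumberField (K i)] [∀ i, IsCMField (K i)] [Fintype I]
  [Nonempty I]

omit [∀ i, IsCMField (K i)] [Nonempty I] in
/-- `|⊔_i Hom(K_i, ℂ)| = Σ_i [K_i : ℚ]`. [folklore] -/
private theorem card_sigma_ringHom_eq_sum' :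
    Fintype.card ((i : I) × (K i →+* ℂ)) = ∑ i, finrank ℚ (K i) := by
  rw [Fintype.card_sigma]
  exact Finset.sum_congr rfl fun i _ => Embeddings.card (K i) ℂ

/-- **A family of CM types of CM fields is nondegenerate iff its rank is additive and every member is nondegenerate**:
`IsNondegenerateFamily Φ ⟺ (cmFamilyRank Φ + |I| = Σ_i cmTypeRank Φ_i + 1 ∧ ∀ i, IsNondegenerate Φ_i)` — on abelian
varieties: `∏_i A_i` is stably nondegenerate iff `Hg(∏_i A_i) = ∏_i Hg(A_i)` and every `A_i` is stably nondegenerate.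
[cite: Gordon1999HodgeAVSurvey, 7.5–7.7] -/
theorem isNondegenerateFamily_iff_add_card_eq_and_forall (Φ : ∀ i, CMType (K i)) :
    CMAlgebra.IsNondegenerateFamily Φ ↔
      CMAlgebra.cmFamilyRank Φ + Fintype.card I = (∑ i, cmTypeRank (Φ i)) + 1 ∧ ∀ i, IsNondegenerate (Φ i) := by
  have key := IsCMTypeWith.typeRank_sigmaType_eq_iff_add_card_eq_and_forall (G := ℂ ≃+* ℂ)
    (Φ := fun i => (Φ i).1) (fun i => isCMTypeWith_conj (Φ i))
  rw [CMAlgebra.isNondegenerateFamily_iff, ← card_sigma_ringHom_eq_sum' (K := K)]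
  refine key.trans (and_congr Iff.rfl (forall_congr' fun i => ?_))
  rw [isNondegenerate_iff, cmTypeRank, ← Embeddings.card (K i) ℂ]

variable {L : Type} [Field L] [NumberField L] [IsAbelianGalois ℚ L]

open scoped Classical in
/-- **Kubota's Lemma 2 for families, qualitative form.**  For CM fields `e_i : K_i ↪ L` inside one ABELIAN number field
`L` (`ι : L → ℂ`, `ρ` the complex conjugation of `L`): the family `Φ` is nondegenerate iff every member `Φ_i` is
nondegenerate AND no odd character `χ` of `Gal(L/ℚ)` is seen by two members (`Σ_{g : ι∘g∘e_i ∈ Φ_i} χ(g) ≠ 0` and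
`Σ_{g : ι∘g∘e_j ∈ Φ_j} χ(g) ≠ 0` for some `i ≠ j`). [cite: Kubota1965, §4 Lemma 2] [cite: Gordon1999HodgeAVSurvey, 7.5 and 9.4.1] -/
theorem isNondegenerateFamily_iff_forall_and_pairwise_oddCharacters (ι : L →+* ℂ) (e : ∀ i, K i →+* L)
    (ρ : L ≃ₐ[ℚ] L) (hρ : ∀ x, ι (ρ x) = starRingEnd ℂ (ι x)) (Φ : ∀ i, CMType (K i)) :
    CMAlgebra.IsNondegenerateFamily Φ ↔ (∀ i, IsNondegenerate (Φ i)) ∧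
      ∀ χ : AddChar (Additive (L ≃ₐ[ℚ] L)) ℂ, χ (Additive.ofMul ρ) = -1 → ∀ i j : I, i ≠ j →
        ¬(∑ g ∈ Finset.univ.filter (fun g : L ≃ₐ[ℚ] L => (ι.comp (g : L →+* L)).comp (e i) ∈ (Φ i).1),
              χ (Additive.ofMul g) ≠ 0 ∧
          ∑ g ∈ Finset.univ.filter (fun g : L ≃ₐ[ℚ] L => (ι.comp (g : L →+* L)).comp (e j) ∈ (Φ j).1),
              χ (Additive.ofMul g) ≠ 0) := by
  rw [isNondegenerateFamily_iff_add_card_eq_and_forall, cmFamilyRank_add_card_eq_iff_pairwise ι e ρ hρ Φ, and_comm]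

/-- **Two members suffice to break it**: if an odd character of `Gal(L/ℚ)` is seen by two different members then the
family is degenerate, WHATEVER the other data (no nondegeneracy hypothesis — contrast `SharedOddCharacterDegenerate`,
where the members' nondegeneracy supplied the non-vanishing). [cite: Kubota1965, §4 Lemma 2] [cite: Gordon1999HodgeAVSurvey, 7.5] -/
theorem not_isNondegenerateFamily_of_oddCharacter_seen_twice (ι : L →+* ℂ) (e : ∀ i, K i →+* L)
    (ρ : L ≃ₐ[ℚ] L) (hρ : ∀ x, ι (ρ x) = starRingEnd ℂ (ι x)) (Φ : ∀ i, CMType (K i))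
    (χ : AddChar (Additive (L ≃ₐ[ℚ] L)) ℂ) (hodd : χ (Additive.ofMul ρ) = -1) {i j : I} (hij : i ≠ j)
    [DecidablePred (· ∈ (Φ i).1)] [DecidablePred (· ∈ (Φ j).1)]
    (hi : ∑ g ∈ Finset.univ.filter (fun g : L ≃ₐ[ℚ] L => (ι.comp (g : L →+* L)).comp (e i) ∈ (Φ i).1),
      χ (Additive.ofMul g) ≠ 0)
    (hj : ∑ g ∈ Finset.univ.filter (fun g : L ≃ₐ[ℚ] L => (ι.comp (g : L →+* L)).comp (e j) ∈ (Φ j).1),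
      χ (Additive.ofMul g) ≠ 0) :
    ¬ CMAlgebra.IsNondegenerateFamily Φ := by
  classical
  rw [isNondegenerateFamily_iff_forall_and_pairwise_oddCharacters ι e ρ hρ Φ]
  rintro ⟨-, h⟩
  refine h χ hodd i j hij ⟨?_, ?_⟩
  · convert hi
  · convert hj

end Fields

end Literature.NumberTheory.ComplexMultiplication
end
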